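import Mathlib
import HarnessLib
import Summits.ResolutionOfSingularities.ResolutionOfSingularities.Theses.WildQuotients
import Summits.ResolutionOfSingularities.ResolutionOfSingularities.Theorems.WildQuotientsWildQuotientResolutionStubQuotientModel
import Summits.ResolutionOfSingularities.ResolutionOfSingularities.Theorems.WildQuotientsWildQuotientResolutionStubBirational
import Summits.ResolutionOfSingularities.ResolutionOfSingularities.Theorems.WildQuotientResolution.Negative.Faithful
import Literature.AlgebraicGeometry.Ramification.InertiaNormalSylow
import Literature.AlgebraicGeometry.Resolution.ResolutionOfSingularities
import Literature.AlgebraicGeometry.Resolution.ComponentGluing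
import Literature.AlgebraicGeometry.Resolution.AlterationsProofs

/-!
# The glued split of `WildQuotientResolution`: Phase 0 ∧ p-closed sub-problem ⇒ the crux — PROVED glue

The glue statement of the line `Sketch` of crux stmt-ResolutionOfSingularities-15640
(`WildQuotients.WildQuotientResolution`), extracted from the composition-checked skeleton
(`Cruxes/WildQuotientResolution/Lines/Sketch.lean`, sha 4d520a71) with its open stubs turned into
HYPOTHESES, so that a planner can file the glued split `WQ ⇐ PhaseZeroModel ∧ PClosedWQ`
(D-0019) with the glue already a theorem:

* `hP0` — PhaseZeroModel: for the crux data (faithful `ρ` suffices), a `G`-equivariant proper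
  birational regular integral model `π : X♯ → X′` on which every inertia group (AS2011 2.4) has a
  normal Sylow `p`-subgroup, with a `G`-stable affine cover (the registered `stub_phaseZero`
  WITHOUT its three engine hypotheses, which are theorems: `stub_localDrop`,
  `stub_hasNormalSylow_iff`, `stub_inertia_le`);
* `hWQp` — PClosedWQ: the crux verbatim + "every inertia group is p-closed" (registered
  `stub_pClosedWQ`, the statement to promote);
(Lemma (L) — finite étale + bijective over a positive-dimensional integral `k`-scheme of finite
type ⇒ birational — is no longer a hypothesis: `Birational.stub_birational_of_bijective`, p138276.)

`wildQuotientResolution_of_phaseZero_of_pClosedWQ : hP0 → hWQp → WildQuotientResolution`, using the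
LANDED glue `QuotientModel.stub_quotientModel` (p138081) and `Birational.stub_birational_of_bijective`
(lemma (L), p138276), `Negative.wqFaithful_iff`
(faithful WLOG), `Scheme.IsRegular.of_topologicalKrullDim_le_zero` (dimension 0) and
`ComponentGluing.Scheme.HasResolution.of_isBirational` (descent of the resolution along
`X♯/G → X₁`).
-/

-- single-problem summit: the doubled namespace component `ResolutionOfSingularities` is forced
set_option linter.dupNamespace false

noncomputable section

open CategoryTheory AlgebraicGeometry TopologicalSpace
open Literature.AlgebraicGeometry.Resolution Literature.AlgebraicGeometry.Ramification
open Summit.ResolutionOfSingularities.ResolutionOfSingularities.Theses.WildQuotients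

namespace Summit.ResolutionOfSingularities.ResolutionOfSingularities.Theorems.WildQuotientResolution.GluedSplit

/-- **The glued split of the crux, proved**: PhaseZeroModel (`hP0`) ∧ PClosedWQ (`hWQp`) ⇒
`WildQuotientResolution`. Reduce to faithful `ρ`; take the Phase-0 model
`X♯`; in dimension `0` the integral `X₁` is regular; otherwise form `Y₁ = X♯/G → X₁`
(`QuotientModel.stub_quotientModel`), birational by (L), resolve `Y₁` by PClosedWQ, and descend.
[folklore] -/
theorem wildQuotientResolution_of_phaseZero_of_pClosedWQ
    (hP0 : ∀ (p : ℕ) (_ : p.Prime) (k : Type) [Field k] [CharP k p] (X' X₁ : Scheme.{0})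
      (f : X₁ ⟶ Spec (.of k)) (q : X' ⟶ X₁) (G : Type) [Group G] [Finite G] (ρ : G →* Aut X'),
      Function.Injective ρ → IsSeparated f → LocallyOfFiniteType f → QuasiCompact f →
      IsIntegral X' → Scheme.IsRegular X' → IsFinite q → (∀ g : G, (ρ g).hom ≫ q = q) →
      ∃ (Xs : Scheme.{0}) (π : Xs ⟶ X') (ρs : G →* Aut Xs), IsProper π ∧ IsBirational π ∧
        IsIntegral Xs ∧ Scheme.IsRegular Xs ∧ (∀ g : G, (ρs g).hom ≫ π = π ≫ (ρ g).hom) ∧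
        (∀ x : Xs, HasNormalSylow p (inertiaSubgroup ρs x)) ∧
        ∀ x : Xs, ∃ U : Xs.Opens, IsAffineOpen U ∧ x ∈ U ∧ ∀ g : G, (ρs g).hom ⁻¹ᵁ U = U)
    (hWQp : ∀ (p : ℕ) (_ : p.Prime) (k : Type) [Field k] [CharP k p] (X' X₁ : Scheme.{0})
      (f : X₁ ⟶ Spec (.of k)) (q : X' ⟶ X₁) (G : Type) [Group G] [Finite G] (ρ : G →* Aut X'),
      IsSeparated f → LocallyOfFiniteType f → QuasiCompact f → IsIntegral X₁ → IsIntegral X' →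
      Scheme.IsRegular X' → IsFinite q → Function.Surjective q.base →
      (∃ U : X₁.Opens, Dense (U : Set X₁) ∧ Etale (q ∣_ U)) → (∀ g : G, (ρ g).hom ≫ q = q) →
      (∀ x y : X', q.base x = q.base y → ∃ g : G, (ρ g).hom.base x = y) →
      (∀ x : X', HasNormalSylow p (inertiaSubgroup ρ x)) → Scheme.HasResolution X₁) :
    WildQuotientResolution := by
  refine Negative.wqFaithful_iff.mp ?_
  intro p hp k _ _ X' X₁ f q G _ _ ρ hfaith hsep hft hqc hX₁ hX' hreg hq hsurj hU hρ horb
  haveI := hsep; haveI := hft; haveI := hqc; haveI := hX'; haveI := hq; haveI := hX₁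
  obtain ⟨Xs, π, ρs, hπ, hbir, hXs, hXsreg, hequiv, hNpS, hcov⟩ :=
    hP0 p hp k X' X₁ f q G ρ hfaith hsep hft hqc hX' hreg hq hρ
  haveI := hπ; haveI := hXs
  by_cases hdim : topologicalKrullDim X₁ ≤ 0
  · exact (Scheme.IsRegular.of_topologicalKrullDim_le_zero hdim).hasResolution
  obtain ⟨Y₁, g, qs, r, hsep₁, hft₁, hqc₁, hY₁, hqsfin, hqssurj, hV, hinv₁, horb₁, hr, -, -, W, hWd,
      hWfin, hWet, hWbij⟩ :=
    QuotientModel.stub_quotientModel p k X' X₁ f q G ρ hfaith hsurj hU hρ horb Xs π ρs hbir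
      hequiv hcov
  haveI := hY₁; haveI := hr; haveI := hWfin; haveI := hWet
  exact ComponentGluing.Scheme.HasResolution.of_isBirational r
    (Birational.stub_birational_of_bijective k f r hdim W hWd hWbij)
    (hWQp p hp k Xs Y₁ g qs G ρs hsep₁ hft₁ hqc₁ hY₁ hXs hXsreg hqsfin hqssurj hV hinv₁ horb₁ hNpS)

end Summit.ResolutionOfSingularities.ResolutionOfSingularities.Theorems.WildQuotientResolution.GluedSplit

end
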